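import Literature.MathematicalPhysics.QuantumFieldTheory.Balaban1983to89.B9Thm312WholeDirBC
import Literature.MathematicalPhysics.QuantumFieldTheory.Balaban1983to89.B9Thm313WholeHolderZ
import Literature.MathematicalPhysics.QuantumFieldTheory.Balaban1983to89.B9Thm313WholeDirZ
import Literature.MathematicalPhysics.QuantumFieldTheory.Balaban1983to89.B9RWSumsDefinitePinsPairM

/-!
# BalabanUVNodes ∕ N06 ([B9], `Dag.B9_main`) — ROWS 20–21's β∕ε-INDEXED PERTURBATION STEPS `StepDirB` DERIVED AT def-Y's MEMBERS, THE LETTER SCHEMAS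
# `Letters313H ∕ Letters313DM` IN dag-n06-l's Z SPECIES AND THE INPUT-NORM LOCALISATION READ THROUGH THE CARRIER-CLASS RELATION (R2-loc engine
# `B9Thm312WholeDirBC.stepDirB_of_letters3131LRCZ`, class-multiplicity transfer) — the CZ-twin of `…StepDirLayerAtPinsBZ.stepDirB_layer_of_lettersZ` (p592181) for edition 24

Track A of `YM-PLAN.md` (cell `pub-ymgap`, HUMAN RULING D-0062), node **N06** = [Balaban1985BackgroundPropagators] Thms 3.1–3.15;
seat `pub-ymgap-dag-n06-d` (s2, «knit N06 at the ₁₁ record»), gen 9.  A HELPER for the stage-11 certificate editions ≥ 22.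

WHAT.  Edition 22 re-leafs rows 20–21 on n06-l g14's Z leaves `thm312Printed_completePairMBZ` ∕ `thm313Printed_completePairMBZ` (R1-cls, the repair of
dag-n06-h's located «C-LETTER-FLAT-AT-ONE» vacuity p582086): the displayed letter schemas `hLH3 ∕ hlettersD13` of the certificate become `Letters313HZ …
(wZ x) (hwZ x) …` ∕ `Letters313DZ … ∧ Letters313DMZ …` (the coarse `Q*`-letters `pXQs`, `dgQsd ∕ pQd` out of the `wZ = n⁻¹`-weighted class).  The
StepDirB layer of editions 17–21 (p570209) feeds the WHOLE structures `hLH3 : Letters313H …`, `hDM : Letters313DM …` to n06-l g12's engine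
`B9Thm312WholeDirB.stepDirB_of_letters3131LR`, which READS ONLY the D-composite fields `pXDv ∕ pYDH ∕ dgDHd` (untouched by the re-classing); n06-l g14
landed the Z-twin engine `B9Thm312WholeDirBZ.stepDirB_of_letters3131LRZ` (same proof, Z binder types).  REPAIR «R2-loc» (located «INPUT-LOC-CLASS-VS-FIBRE», dag-n06-w3 `hLIM_pins_false` p594766): the engine's
false-at-the-pins input `hlocX` (class ⊆ fibre) and `hdomX` are REPLACED by a class relation `Rel` with multiplicity `mR` (`hmult`), class-constant distance (`hRel`) and the two TRUE
facts `hvanishX ∕ hleX` (n06-l `stepDirB_of_letters3131LRCZ` over `B9BlockNormClassTransfer.hasMaj_of_dom_classes`); θ_I(ε) := 2((mR·B₀·L₀ + B_iD(ε))tc).  OTHERWISE this file is p592181 ∕ p570209 with: two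
binders `(wZ : ∀ x, (geo9Y x).Site → ℝ) (hwZ : ∀ x y, 0 < wZ x y)` before `hLH3`; `hLH3 : … Letters313HZ (𝔬12 x) (𝔭A x) 1 (H x) (hgeo x) (wZ x) (hwZ x)
(bH13 x) BhD13 Bx13 δ12₃ U`; `hDM : … Letters313DMZ (𝔬12 x) (𝔭A x) (Dd x) 1 (H x) (hgeo x) (wZ x) (hwZ x) B12₃ Bq12 δ12₃ (bH13 x) U`; the per-member
application `stepDirB_of_letters3131LR ↦ stepDirB_of_letters3131LRZ`; ★★ `stepDirB_layer_of_lettersZ` — statement, choices (θ_D′ := max(θ_D, 2(B₀ +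
κ⁺B₃)tc), θ_H(β), θ_I(ε) by formula at the row-sum constant c, threshold M₀′) and conclusion `∃ θD′ θH θI M₀′, … LeftStep … ∧ (StepDirB … ∧ StepL2 …)`
otherwise IDENTICAL (the certificate pins `wZ x y := ((((ℓ+1 : ℕ) : ℝ)^(d+1))^(lvl y))⁻¹ = n_y⁻¹`).
HONEST FRAMING.  Kernel bookkeeping (thresholds, one maximum, two functions by formula, one application of n06-l's Z engine per member, four arithmetic
dominations); COUNT-NEUTRAL; nothing of [B9] asserted — the letter schemas remain displayed hypotheses about the genuine operators; N06 NOT discharged.  One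
finite 𝕋⁴ programme at fixed `ε` — NOT continuum, NOT OS, NOT the mass gap ∕ Clay.  0 `def`, 0 `sorry`.
-/

noncomputable section

namespace Summit.QuantumFields.YangMills.BalabanUVNodes.N06StepDirLayerAtPinsBCZ

open Literature.MathematicalPhysics.QuantumFieldTheory.Balaban1983to89
open Literature.MathematicalPhysics.QuantumFieldTheory.Balaban1983to89.B9Thm34Ext (toB6)
open Literature.MathematicalPhysics.QuantumFieldTheory.Balaban1983to89.B11SectG (BlockNorm HasMaj RowSum)
open Literature.MathematicalPhysics.QuantumFieldTheory.Balaban1983to89.B9Thm312Whole (GeoOK cNorm)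
open Literature.MathematicalPhysics.QuantumFieldTheory.Balaban1983to89.B9Thm312WholeClasses (cNormR)
open Literature.MathematicalPhysics.QuantumFieldTheory.Balaban1983to89.B9Thm312WholeLeft (LeftStep)
open Literature.MathematicalPhysics.QuantumFieldTheory.Balaban1983to89.B9Thm312WholeDir (Thm33G0Dir)
open Literature.MathematicalPhysics.QuantumFieldTheory.Balaban1983to89.B9Thm312WholeDirB (StepDirB) open Literature.MathematicalPhysics.QuantumFieldTheory.Balaban1983to89.B9Thm312WholeDirBC (stepDirB_of_letters3131LRCZ)
open Literature.MathematicalPhysics.QuantumFieldTheory.Balaban1983to89.B9Thm313WholeDir (Thm33G0DirR) open Literature.MathematicalPhysics.QuantumFieldTheory.Balaban1983to89.B9Thm313WholeDirZ (Letters313DMZ)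
open Literature.MathematicalPhysics.QuantumFieldTheory.Balaban1983to89.B9Thm313WholeHolderZ (Letters313HZ)
open Literature.MathematicalPhysics.QuantumFieldTheory.Balaban1983to89.B9Thm312WholeL2 (StepL2)
open Literature.MathematicalPhysics.QuantumFieldTheory.Balaban1983to89.B9RWSums343Holder (HolderProbes)
open Literature.MathematicalPhysics.QuantumFieldTheory.Balaban1983to89.B9RWSums343to347Whole (Facts347)
open Literature.MathematicalPhysics.QuantumFieldTheory.Balaban1983to89.B9RWSumsDefinitePins (PinPrims)
open Literature.MathematicalPhysics.QuantumFieldTheory.Balaban1983to89.B9RWSums347DefiniteFaces (exp261 lemma21Pack_geo9Y)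
open Literature.MathematicalPhysics.QuantumFieldTheory.Balaban1983to89.B9PinMembersKLevelV1 (MemberY geo9Y)
open Literature.MathematicalPhysics.QuantumFieldTheory.Balaban1983to89.B9GeoLemma21KLevelV1 (geo9Y_len_pos rowSum261_geo9Y)
open Literature.MathematicalPhysics.QuantumFieldTheory.Balaban1983to89.B9Thm312WholeStepFrom3131 (Letters3131)
open Literature.MathematicalPhysics.QuantumFieldTheory.Balaban1983to89.B9Thm312WholeLeftStepFrom3131 (Letters3131H)
open Literature.MathematicalPhysics.QuantumFieldTheory.Balaban1983to89.B9Thm312WholeStepDirFrom3131 (Thm33G0DirX)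
open Literature.MathematicalPhysics.QuantumFieldTheory.Balaban1983to89.B9Thm312WholeRightStepFrom3131 (Letters3131R Thm33G0DivR)

variable {d ℓ : ℕ} {hd : 1 ≤ d + 1} {hL : Odd (ℓ + 1) ∧ 1 < ℓ + 1} {b₀ b₁ : ℝ} {Mstar : ℕ}
variable [∀ x : MemberY d ℓ hd hL b₀ b₁ Mstar, Fintype (geo9Y x).Site]
variable {c35 : ℝ} {bg : MemberY d ℓ hd hL b₀ b₁ Mstar → B9.Backgrounds}

/-- the pointwise domination pattern with the cutting constant: `κ ≤ κM`, `0 ≤ b` and `2((a + κM·b)·t·c) ≤ θ` give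
`2((a + κ·b)·(t·m)·c) ≤ θ·m`. [folklore] -/
private theorem dom_two {a κ κM b t m c θ : ℝ} (hκ : κ ≤ κM) (hb0 : 0 ≤ b)
    (ht : 0 ≤ t) (hm : 0 ≤ m) (hc : 0 ≤ c) (hθ : 2 * ((a + κM * b) * t * c) ≤ θ) : 2 * ((a + κ * b) * (t * m) * c) ≤ θ * m := by
  have h1 : κ * b ≤ κM * b := mul_le_mul_of_nonneg_right hκ hb0
  have h2 : a + κ * b ≤ a + κM * b := by linarith only [h1]
  have h3 : (a + κ * b) * t * c ≤ (a + κM * b) * t * c := mul_le_mul_of_nonneg_right (mul_le_mul_of_nonneg_right h2 ht) hc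
  calc 2 * ((a + κ * b) * (t * m) * c) = 2 * ((a + κ * b) * t * c) * m := by ring
    _ ≤ 2 * ((a + κM * b) * t * c) * m := mul_le_mul_of_nonneg_right (by linarith only [h3]) hm
    _ ≤ θ * m := mul_le_mul_of_nonneg_right hθ hm

/-- the pointwise domination with the lattice factor: `2(A·t·c·L) ≤ θ` gives `2(A·(t·m)·c·L) ≤ θ·m`. [folklore] -/
private theorem dom_L {A t m c L θ : ℝ} (hm : 0 ≤ m) (hθ : 2 * (A * t * c * L) ≤ θ) : 2 * (A * (t * m) * c * L) ≤ θ * m := by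
  calc 2 * (A * (t * m) * c * L) = 2 * (A * t * c * L) * m := by ring
    _ ≤ θ * m := mul_le_mul_of_nonneg_right hθ hm

/-- the pointwise domination without extra factors: `2(A·t·c) ≤ θ` gives `2(A·(t·m)·c) ≤ θ·m`. [folklore] -/
private theorem dom_one {A t m c θ : ℝ} (hm : 0 ≤ m) (hθ : 2 * (A * t * c) ≤ θ) : 2 * (A * (t * m) * c) ≤ θ * m := by
  calc 2 * (A * (t * m) * c) = 2 * (A * t * c) * m := by ring
    _ ≤ θ * m := mul_le_mul_of_nonneg_right hθ hm

set_option maxHeartbeats 400000 in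
/-- **Z-TWIN (edition 22)** of p570209's `stepDirB_layer_of_letters`: binders `wZ hwZ` added, `hLH3 : Letters313HZ …`, `hDM : Letters313DMZ …` (dag-n06-l R1-cls species), engine = n06-l `B9Thm312WholeDirBZ.stepDirB_of_letters3131LRZ`; otherwise — ★★ **ROWS 20–21's `StepDirB` DERIVED AT def-Y's MEMBERS, AFTER THE G₀ LAYER, WITH β-INDEXED θ_H AND ε-INDEXED θ_I** (module docstring).  Inputs:
`q : PinPrims` (for n06-k's member facts); the Hölder probes `𝔭A`, the single-direction letters `Dd ∕ Dds`, the input norm `bHXA`, the Theorem-3.12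
letters `𝔬12`, the scalar-field Hölder norm `bH13` (cutting constant ≦ κ13) and input norms `bHW13`; the geometry facts `hgeo`; the core helper's
outputs in its regime (M₀, a₀): `hleft` (`LeftStep` at θD), `h33` (`Thm33G0Dir` with constants B12₀, Bh12), `h33R` (`Thm33G0DirR`) and their signs;
the displayed schemas in Theorem 3.12's regime (M12, a12) with `M12 ≤ M₀`, `a₀ ≤ a12`: `hLH3 hDM hX hdiv hdomX hlocX hL3131 hL3131H hR hstepL2`; the
majorant letters' signs (NO uniform bounds); the rates.  Output: `∃ θD' (θH θI : ℝ → ℝ) M₀'`, `0 ≤ θD'`, `θH β ≥ 0` for β ∈ [0,1), `θI ε ≥ 0` for ε > 0,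
`M₀ ≤ M₀'`, and in the regime (M₀′, a₀): `LeftStep` at θD′ and `StepDirB θD′·Mα₀ (fun β => θH β·Mα₀) (fun ε => θI ε·Mα₀) δK12 ∧ StepL2`.  Nothing of
print asserted.
[cite: Balaban1985BackgroundPropagators, Thm 3.12 p.423 + (3.130)–(3.131) pp.421–422 + (3.137)–(3.138) p.423 + (3.42)–(3.45) pp.397–398 + p.398 + p.421; Balaban1984PropagatorsII, Lemma 2.1 (2.61) p.234 + (2.26) p.228] -/
theorem stepDirB_layer_of_lettersCZ {X Y PX PY Z W P : MemberY d ℓ hd hL b₀ b₁ Mstar → Type}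
    [∀ x, Fintype (X x)] [∀ x, Fintype (Y x)] [∀ x, Fintype (PX x)] [∀ x, Fintype (PY x)] [∀ x, Fintype (Z x)] [∀ x, Fintype (W x)]
    [∀ x, Fintype (P x)]
    (q : PinPrims) (hq : q.OK) (H : MemberY d ℓ hd hL b₀ b₁ Mstar → Prop)
    (𝔭A : ∀ x : MemberY d ℓ hd hL b₀ b₁ Mstar, HolderProbes (geo9Y x) (bg x) (X x) (Y x) (PX x) (PY x))
    (Dd Dds : ∀ x : MemberY d ℓ hd hL b₀ b₁ Mstar, (bg x).Cfg → P x → Module.End ℝ (X x → ℝ))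
    (bHXA : ∀ x : MemberY d ℓ hd hL b₀ b₁ Mstar, ℝ → BlockNorm (toB6 (geo9Y x) 1 (H x)) (X x → ℝ))
    (𝔬12 : ∀ x : MemberY d ℓ hd hL b₀ b₁ Mstar, B9Thm312Whole.Ops (geo9Y x) (bg x) (X x) (Y x) (Z x) (W x))
    (bH13 : ∀ x : MemberY d ℓ hd hL b₀ b₁ Mstar, BlockNorm (toB6 (geo9Y x) 1 (H x)) (W x → ℝ)) (κ13 : ℝ) (hκ13 : ∀ x, (bH13 x).κ ≤ κ13)
    (bHW13 : ∀ x : MemberY d ℓ hd hL b₀ b₁ Mstar, ℝ → BlockNorm (toB6 (geo9Y x) 1 (H x)) (W x → ℝ))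
    (hgeo : ∀ x : MemberY d ℓ hd hL b₀ b₁ Mstar, GeoOK (geo9Y x))
    -- numerics: the core helper's constants ∕ thresholds and the certificate's rates (NO β-∕ε-uniform bounds)
    (B12₀ δ12₀ δK12 B12₃ δ12₃ t12 δT12 ρS σS θD θ2₁₂ M₀ a₀ M12 a12 : ℝ) (Bh12 Bi12 Bq12 BhD13 Bx13 Bx0 BdX BiD BdD : ℝ → ℝ)
    (Bi2₁₂ : ℝ → ℝ → ℝ)
    (hB12₀ : 0 ≤ B12₀) (hB12₃ : 0 ≤ B12₃) (ht12 : 0 ≤ t12) (hθD : 0 ≤ θD) (hM₀ : 0 < M₀) (hMM : M12 ≤ M₀) (haa : a₀ ≤ a12)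
    (hBh12 : ∀ β, 0 ≤ β → β < 1 → 0 ≤ Bh12 β)
    (hBhD13 : ∀ β, 0 ≤ β → β < 1 → 0 ≤ BhD13 β) (hBx13 : ∀ β, 0 ≤ β → β < 1 → 0 ≤ Bx13 β) (hBx0 : ∀ β, 0 ≤ β → β < 1 → 0 ≤ Bx0 β)
    (hBdX : ∀ β, 0 ≤ β → β < 1 → 0 ≤ BdX β) (hBiD : ∀ ε, 0 < ε → 0 ≤ BiD ε)
    (hσS : 0 < σS) (hρST : ρS ≤ δT12) (hρS₀ : ρS + σS ≤ δ12₀) (hρS₃ : ρS + σS ≤ δ12₃) (hδK0 : 0 ≤ δK12)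
    (hδKS : δK12 + q.αF * ((1 - 2 * q.α) * q.δ₀) ≤ ρS)
    -- the core helper's output families in its regime (M₀, a₀)
    (hleft : ∀ x : MemberY d ℓ hd hL b₀ b₁ Mstar, M₀ ≤ (geo9Y x).M → ∀ α₀ : ℝ, 0 < α₀ → (geo9Y x).M * α₀ ≤ a₀ →
      ∀ U : (bg x).Cfg, (bg x).Reg335 c35 α₀ U → (bg x).Reg336 c35 α₀ U →
        LeftStep (𝔬12 x) 1 (H x) (fun y => (geo9Y_len_pos x y).le) B12₀ δ12₀ (θD * ((geo9Y x).M * α₀)) δK12 U)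
    (h33 : ∀ x : MemberY d ℓ hd hL b₀ b₁ Mstar, M₀ ≤ (geo9Y x).M → ∀ α₀ : ℝ, 0 < α₀ → (geo9Y x).M * α₀ ≤ a₀ →
      ∀ U : (bg x).Cfg, (bg x).Reg335 c35 α₀ U → (bg x).Reg336 c35 α₀ U →
        Thm33G0Dir (𝔬12 x) (𝔭A x) (Dd x) (Dds x) 1 (H x) (bHXA x) B12₀ Bh12 Bi12 Bi2₁₂ δ12₀ U)
    (h33R : ∀ x : MemberY d ℓ hd hL b₀ b₁ Mstar, M₀ ≤ (geo9Y x).M → ∀ α₀ : ℝ, 0 < α₀ → (geo9Y x).M * α₀ ≤ a₀ →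
      ∀ U : (bg x).Cfg, (bg x).Reg335 c35 α₀ U → (bg x).Reg336 c35 α₀ U → Thm33G0DirR (𝔬12 x) (Dds x) 1 (H x) B12₀ δ12₀ U)
    -- the displayed schemas of rows 20–21 in Theorem 3.12's regime (M12, a12)
    (wZ : ∀ x : MemberY d ℓ hd hL b₀ b₁ Mstar, (geo9Y x).Site → ℝ) (hwZ : ∀ (x : MemberY d ℓ hd hL b₀ b₁ Mstar) (y : (geo9Y x).Site), 0 < wZ x y)
    (hLH3 : ∀ x : MemberY d ℓ hd hL b₀ b₁ Mstar, M12 ≤ (geo9Y x).M → ∀ α₀ : ℝ, 0 < α₀ → (geo9Y x).M * α₀ ≤ a12 →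
      ∀ U : (bg x).Cfg, (bg x).Reg335 c35 α₀ U → (bg x).Reg336 c35 α₀ U →
        Letters313HZ (𝔬12 x) (𝔭A x) 1 (H x) (hgeo x) (wZ x) (hwZ x) (bH13 x) BhD13 Bx13 δ12₃ U)
    (hDM : ∀ x : MemberY d ℓ hd hL b₀ b₁ Mstar, M12 ≤ (geo9Y x).M → ∀ α₀ : ℝ, 0 < α₀ → (geo9Y x).M * α₀ ≤ a12 →
      ∀ U : (bg x).Cfg, (bg x).Reg335 c35 α₀ U → (bg x).Reg336 c35 α₀ U →
        Letters313DMZ (𝔬12 x) (𝔭A x) (Dd x) 1 (H x) (hgeo x) (wZ x) (hwZ x) B12₃ Bq12 δ12₃ (bH13 x) U)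
    (hX : ∀ x : MemberY d ℓ hd hL b₀ b₁ Mstar, M12 ≤ (geo9Y x).M → ∀ α₀ : ℝ, 0 < α₀ → (geo9Y x).M * α₀ ≤ a12 →
      ∀ U : (bg x).Cfg, (bg x).Reg335 c35 α₀ U → (bg x).Reg336 c35 α₀ U →
        Thm33G0DirX (𝔬12 x) (𝔭A x) (Dd x) 1 (H x) (fun y => (geo9Y_len_pos x y).le) (bH13 x) Bx0 BdX δ12₀ δ12₃ U)
    (hdiv : ∀ x : MemberY d ℓ hd hL b₀ b₁ Mstar, M12 ≤ (geo9Y x).M → ∀ α₀ : ℝ, 0 < α₀ → (geo9Y x).M * α₀ ≤ a12 →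
      ∀ U : (bg x).Cfg, (bg x).Reg335 c35 α₀ U → (bg x).Reg336 c35 α₀ U →
        Thm33G0DivR (𝔬12 x) (Dds x) 1 (H x) (fun y => (geo9Y_len_pos x y).le) (bHXA x) (bHW13 x) BiD BdD δ12₀ δ12₃ U)
    -- R2-loc (dag-n06-l g15 `Letters313IMBC` ∕ `stepDirB_of_letters3131LRCZ`): the input norm's localisation is read against the fibre blocks through a CLASS relation
    (Rel : ∀ x : MemberY d ℓ hd hL b₀ b₁ Mstar, (geo9Y x).Site → (geo9Y x).Site → Prop) [∀ x, DecidableRel (Rel x)] (mR : ℝ) (hmR : 0 ≤ mR)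
    (hmult : ∀ (x : MemberY d ℓ hd hL b₀ b₁ Mstar) (y' : (geo9Y x).Site), ((Finset.univ.filter (fun y'' => Rel x y'' y')).card : ℝ) ≤ mR)
    (hRel : ∀ (x : MemberY d ℓ hd hL b₀ b₁ Mstar) (a b b' : (geo9Y x).Site), Rel x b' b → (geo9Y x).dist a b' = (geo9Y x).dist a b)
    (hvanishX : ∀ x : MemberY d ℓ hd hL b₀ b₁ Mstar, M12 ≤ (geo9Y x).M → ∀ α₀ : ℝ, 0 < α₀ → (geo9Y x).M * α₀ ≤ a12 →
      ∀ U : (bg x).Cfg, (bg x).Reg335 c35 α₀ U → (bg x).Reg336 c35 α₀ U →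
        ∀ ε : ℝ, 0 < ε → ∀ (y' : (geo9Y x).Site) (μ : X x → ℝ), (bHXA x ε).IsLoc y' μ → ∀ y'' : (geo9Y x).Site, ¬ Rel x y'' y' →
          (BlockNorm.ofBlocks (toB6 (geo9Y x) 1 (H x)) (𝔬12 x).blk).cut y'' μ = 0)
    (hleX : ∀ x : MemberY d ℓ hd hL b₀ b₁ Mstar, M12 ≤ (geo9Y x).M → ∀ α₀ : ℝ, 0 < α₀ → (geo9Y x).M * α₀ ≤ a12 →
      ∀ U : (bg x).Cfg, (bg x).Reg335 c35 α₀ U → (bg x).Reg336 c35 α₀ U →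
        ∀ ε : ℝ, 0 < ε → ∀ (y' : (geo9Y x).Site) (μ : X x → ℝ), (bHXA x ε).IsLoc y' μ → ∀ y'' : (geo9Y x).Site, Rel x y'' y' →
          (BlockNorm.ofBlocks (toB6 (geo9Y x) 1 (H x)) (𝔬12 x).blk).loc y'' ((BlockNorm.ofBlocks (toB6 (geo9Y x) 1 (H x)) (𝔬12 x).blk).cut y'' μ) ≤ (bHXA x ε).loc y' μ)
    (Ta Ta₂ Ta' Ta₂' : ∀ x : MemberY d ℓ hd hL b₀ b₁ Mstar, (bg x).Cfg → Module.End ℝ (X x → ℝ))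
    (Tb Tb₂ : ∀ x : MemberY d ℓ hd hL b₀ b₁ Mstar, (bg x).Cfg → (X x → ℝ) →ₗ[ℝ] (W x → ℝ))
    (Tb' Tb₂' : ∀ x : MemberY d ℓ hd hL b₀ b₁ Mstar, (bg x).Cfg → (W x → ℝ) →ₗ[ℝ] (X x → ℝ))
    (hL3131 : ∀ x : MemberY d ℓ hd hL b₀ b₁ Mstar, M12 ≤ (geo9Y x).M → ∀ α₀ : ℝ, 0 < α₀ → (geo9Y x).M * α₀ ≤ a12 →
      ∀ U : (bg x).Cfg, (bg x).Reg335 c35 α₀ U → (bg x).Reg336 c35 α₀ U →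
        Letters3131 (𝔬12 x) (Ta x) (Ta₂ x) (Tb x) (Tb₂ x) 1 (H x) (fun y => (geo9Y_len_pos x y).le) (t12 * ((geo9Y x).M * α₀)) δT12 U)
    (hL3131H : ∀ x : MemberY d ℓ hd hL b₀ b₁ Mstar, M12 ≤ (geo9Y x).M → ∀ α₀ : ℝ, 0 < α₀ → (geo9Y x).M * α₀ ≤ a12 →
      ∀ U : (bg x).Cfg, (bg x).Reg335 c35 α₀ U → (bg x).Reg336 c35 α₀ U →
        Letters3131H (𝔬12 x) (Tb x) (Tb₂ x) 1 (H x) (fun y => (geo9Y_len_pos x y).le) (bH13 x) (t12 * ((geo9Y x).M * α₀)) δT12 U)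
    (hR : ∀ x : MemberY d ℓ hd hL b₀ b₁ Mstar, M12 ≤ (geo9Y x).M → ∀ α₀ : ℝ, 0 < α₀ → (geo9Y x).M * α₀ ≤ a12 →
      ∀ U : (bg x).Cfg, (bg x).Reg335 c35 α₀ U → (bg x).Reg336 c35 α₀ U →
        Letters3131R (𝔬12 x) (Ta' x) (Ta₂' x) (Tb' x) (Tb₂' x) 1 (H x) (fun y => (geo9Y_len_pos x y).le) (t12 * ((geo9Y x).M * α₀)) δT12 U)
    (hstepL2 : ∀ x : MemberY d ℓ hd hL b₀ b₁ Mstar, M12 ≤ (geo9Y x).M → ∀ α₀ : ℝ, 0 < α₀ → (geo9Y x).M * α₀ ≤ a12 →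
      ∀ U : (bg x).Cfg, (bg x).Reg335 c35 α₀ U → (bg x).Reg336 c35 α₀ U →
        StepL2 (𝔬12 x) 1 (H x) (θ2₁₂ * ((geo9Y x).M * α₀)) δK12 U) :
    ∃ (θD' : ℝ) (θH θI : ℝ → ℝ) (M₀' : ℝ), 0 ≤ θD' ∧ (∀ β, 0 ≤ β → β < 1 → 0 ≤ θH β) ∧ (∀ ε, 0 < ε → 0 ≤ θI ε) ∧ M₀ ≤ M₀' ∧
      (∀ x : MemberY d ℓ hd hL b₀ b₁ Mstar, M₀' ≤ (geo9Y x).M → ∀ α₀ : ℝ, 0 < α₀ → (geo9Y x).M * α₀ ≤ a₀ →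
        ∀ U : (bg x).Cfg, (bg x).Reg335 c35 α₀ U → (bg x).Reg336 c35 α₀ U →
          LeftStep (𝔬12 x) 1 (H x) (fun y => (geo9Y_len_pos x y).le) B12₀ δ12₀ (θD' * ((geo9Y x).M * α₀)) δK12 U) ∧
      (∀ x : MemberY d ℓ hd hL b₀ b₁ Mstar, M₀' ≤ (geo9Y x).M → ∀ α₀ : ℝ, 0 < α₀ → (geo9Y x).M * α₀ ≤ a₀ →
        ∀ U : (bg x).Cfg, (bg x).Reg335 c35 α₀ U → (bg x).Reg336 c35 α₀ U →
          StepDirB (𝔬12 x) (𝔭A x) (Dd x) (Dds x) 1 (H x) (bHXA x) (fun y => (geo9Y_len_pos x y).le) (θD' * ((geo9Y x).M * α₀))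
            (fun β => θH β * ((geo9Y x).M * α₀)) (fun ε => θI ε * ((geo9Y x).M * α₀)) δK12 U ∧
          StepL2 (𝔬12 x) 1 (H x) (θ2₁₂ * ((geo9Y x).M * α₀)) δK12 U) := by
  -- p. 398's member facts at ((1 − 2α)δ₀, α_F) and [4] (2.61) at the rate σS, above ONE threshold each (n06-k ∕ n06-i)
  obtain ⟨ML, -, hfacts, -⟩ :=
    lemma21Pack_geo9Y (d := d) (ℓ := ℓ) (hd := hd) (hL := hL) (b₀ := b₀) (b₁ := b₁) (Mstar := Mstar) H hq.α_pos hq.α_lt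
      hq.δ₀_pos hq.αF_pos (by linarith only [hq.αF_lt])
  obtain ⟨MLσ, cσ, hrow0⟩ := rowSum261_geo9Y (d := d) (ℓ := ℓ) (hd := hd) (hL := hL) (b₀ := b₀) (b₁ := b₁) (Mstar := Mstar) σS hσS
  set c : ℝ := max cσ 0 with hc'
  have hc0 : 0 ≤ c := le_max_right _ _
  have hrow : ∀ x : MemberY d ℓ hd hL b₀ b₁ Mstar, MLσ ≤ (geo9Y x).M → RowSum (toB6 (geo9Y x) 1 (H x)) σS c :=
    fun x hM y => (hrow0 x hM y).trans (le_max_left _ _)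
  set L₀ : ℝ := ((ℓ + 1 : ℕ) : ℝ) with hL₀
  have hL₀0 : 0 ≤ L₀ := by rw [hL₀]; positivity
  set κM : ℝ := max κ13 0 with hκM
  have hκM0 : 0 ≤ κM := le_max_right _ _
  -- the step constants BY CHOICE: θ_D′ a number, θ_H and θ_I FUNCTIONS of the exponent (print: B₀(β), B′₀(ε), pp. 397–398)
  set θD' : ℝ := max θD (2 * ((B12₀ + κM * B12₃) * t12 * c)) with hθD'
  set θH : ℝ → ℝ := fun β => 2 * ((Bh12 β + κM * BhD13 β) * t12 * c) + 2 * ((Bh12 β + κM * BdX β) * t12 * c) +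
    2 * ((Bx0 β + Bx13 β) * t12 * c * L₀) with hθH
  set θI : ℝ → ℝ := fun ε => 2 * ((mR * B12₀ * L₀ + BiD ε) * t12 * c) with hθI
  set M₀' : ℝ := max M₀ (max ML MLσ) with hM₀'
  have hθD'0 : 0 ≤ θD' := hθD.trans (le_max_left _ _)
  have hH1 : ∀ β, 0 ≤ β → β < 1 → 0 ≤ 2 * ((Bh12 β + κM * BhD13 β) * t12 * c) := fun β h0 h1 =>
    mul_nonneg (by norm_num) (mul_nonneg (mul_nonneg (add_nonneg (hBh12 β h0 h1) (mul_nonneg hκM0 (hBhD13 β h0 h1))) ht12) hc0)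
  have hH2 : ∀ β, 0 ≤ β → β < 1 → 0 ≤ 2 * ((Bh12 β + κM * BdX β) * t12 * c) := fun β h0 h1 =>
    mul_nonneg (by norm_num) (mul_nonneg (mul_nonneg (add_nonneg (hBh12 β h0 h1) (mul_nonneg hκM0 (hBdX β h0 h1))) ht12) hc0)
  have hH3 : ∀ β, 0 ≤ β → β < 1 → 0 ≤ 2 * ((Bx0 β + Bx13 β) * t12 * c * L₀) := fun β h0 h1 =>
    mul_nonneg (by norm_num) (mul_nonneg (mul_nonneg (mul_nonneg (add_nonneg (hBx0 β h0 h1) (hBx13 β h0 h1)) ht12) hc0) hL₀0)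
  have hθH0 : ∀ β, 0 ≤ β → β < 1 → 0 ≤ θH β := fun β h0 h1 => by
    simp only [hθH]; linarith only [hH1 β h0 h1, hH2 β h0 h1, hH3 β h0 h1]
  have hθI0 : ∀ ε, 0 < ε → 0 ≤ θI ε := fun ε hε => by
    simp only [hθI]
    exact mul_nonneg (by norm_num) (mul_nonneg (mul_nonneg (add_nonneg (mul_nonneg (mul_nonneg hmR hB12₀) hL₀0) (hBiD ε hε)) ht12) hc0)
  have hαFδ : 0 ≤ q.αF * ((1 - 2 * q.α) * q.δ₀) :=
    mul_nonneg hq.αF_pos.le (mul_nonneg (by linarith only [hq.α_lt]) hq.δ₀_pos.le)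
  refine ⟨θD', θH, θI, M₀', hθD'0, hθH0, hθI0, le_max_left _ _, fun x hM α₀ hα ha U hU hU' => ?_,
    fun x hM α₀ hα ha U hU hU' => ?_⟩
  all_goals
    have hM0x : M₀ ≤ (geo9Y x).M := (le_max_left _ _).trans hM
    have hM12x : M12 ≤ (geo9Y x).M := hMM.trans hM0x
    have hMLx : ML ≤ (geo9Y x).M := ((le_max_left _ _).trans (le_max_right _ _)).trans hM
    have hMLσx : MLσ ≤ (geo9Y x).M := ((le_max_right _ _).trans (le_max_right _ _)).trans hM
    have ha12x : (geo9Y x).M * α₀ ≤ a12 := ha.trans haa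
    have hMpos : 0 < (geo9Y x).M := lt_of_lt_of_le hM₀ hM0x
    have hMα : 0 ≤ (geo9Y x).M * α₀ := mul_nonneg hMpos.le hα.le
    have hw : ∀ a b : (geo9Y x).Site, θD * ((geo9Y x).M * α₀) * Real.exp (-(δK12 * (toB6 (geo9Y x) 1 (H x)).dist a b)) ≤
        θD' * ((geo9Y x).M * α₀) * Real.exp (-(δK12 * (toB6 (geo9Y x) 1 (H x)).dist a b)) := fun a b =>
      mul_le_mul_of_nonneg_right (mul_le_mul_of_nonneg_right (le_max_left _ _) hMα) (Real.exp_nonneg _)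
  · obtain ⟨he1, hsd, hsd1⟩ := hleft x hM0x α₀ hα ha U hU hU'
    exact ⟨he1, hsd.mono hw, hsd1.mono hw⟩
  · have hκx : (bH13 x).κ ≤ κM := (hκ13 x).trans (le_max_left _ _)
    have hS := stepDirB_of_letters3131LRCZ (R₀ := 1) (H₀ := H x) (hgeo x) (hfacts x hMLx) (hrow x hMLσx) hc0 hB12₀ hB12₃
      (mul_nonneg ht12 hMα) hBh12 hBhD13 hBx13 hBx0 hBdX hBiD (Rel x) hmR (hmult x) (hRel x) hρST hρS₀ hρS₃ hαFδ hδK0 hδKS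
      (θD := θD' * ((geo9Y x).M * α₀)) (θH := fun β => θH β * ((geo9Y x).M * α₀)) (θI := fun ε => θI ε * ((geo9Y x).M * α₀))
      (dom_two hκx hB12₃ ht12 hMα hc0 (le_max_right _ _))
      (fun β hβ0 hβ1 => dom_two hκx (hBhD13 β hβ0 hβ1) ht12 hMα hc0 (by
        simp only [hθH]; linarith only [hH2 β hβ0 hβ1, hH3 β hβ0 hβ1]))
      (fun β hβ0 hβ1 => dom_two hκx (hBdX β hβ0 hβ1) ht12 hMα hc0 (by
        simp only [hθH]; linarith only [hH1 β hβ0 hβ1, hH3 β hβ0 hβ1]))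
      (fun β hβ0 hβ1 => dom_L hMα (by simp only [hθH]; linarith only [hH1 β hβ0 hβ1, hH2 β hβ0 hβ1]))
      (fun ε hε => dom_one hMα (by simp only [hθI]; exact le_rfl))
      (h33 x hM0x α₀ hα ha U hU hU') (h33R x hM0x α₀ hα ha U hU hU') (hLH3 x hM12x α₀ hα ha12x U hU hU')
      (hDM x hM12x α₀ hα ha12x U hU hU') (hX x hM12x α₀ hα ha12x U hU hU') (hdiv x hM12x α₀ hα ha12x U hU hU')
      (hvanishX x hM12x α₀ hα ha12x U hU hU') (hleX x hM12x α₀ hα ha12x U hU hU') (hL3131 x hM12x α₀ hα ha12x U hU hU')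
      (hL3131H x hM12x α₀ hα ha12x U hU hU') (hR x hM12x α₀ hα ha12x U hU hU')
    exact ⟨hS, hstepL2 x hM12x α₀ hα ha12x U hU hU'⟩

end Summit.QuantumFields.YangMills.BalabanUVNodes.N06StepDirLayerAtPinsBCZ

end
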